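import Mathlib
import HarnessLib
import Literature.AlgebraicGeometry.Resolution.ProjectiveSpaceRegular
import Summits.ResolutionOfSingularities.ResolutionOfSingularities.Theorems.WildQuotientsWildQuotientResolutionS1aStubInitialAtlas
import Summits.ResolutionOfSingularities.ResolutionOfSingularities.Theorems.WildQuotientsWildQuotientResolutionS1aTerminalLocus

/-!
# S1a — (T0b) the `m = 0` packaging: REGULAR rings are tame root charts; KILL points are good

[OURS · L1 W4.5c · lead-1 g6; STRATEGY-DESIGN v2 §5 (T0)(b), §6.1] — NOT statements of the manuscript; counted 0;
AI-level work, weaker than expert review. Crux stmt-ResolutionOfSingularities-17941, line `s1a-logminvertex` v5, stub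
`stub_strategy` (ladder rung T0).

* `isTameRootChart_of_isRegularRing` — a Noetherian regular ring is a tame root chart (trivial grading `m = 0`,
  `𝒜 _ = ⊤`, no units needed: the index group is trivial) — the packaging shared with `stub_initialAtlas`;
* `locallyTameRootRegular_of_isRegular` — a regular locally Noetherian scheme is locally tame-root-regular;
* `GModel.isGoodAt_of_isRegularRing_invariants` — TERMINAL RECOGNITION AT KILL POINTS: a point lying in a `G`-stable
  affine open, affine over the base, whose ring of invariants is Noetherian and REGULAR (e.g. by Király–Lütkebohmert after
  a Rees kill, H1) is not in the bad locus.
-/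

set_option linter.dupNamespace false

noncomputable section

open CategoryTheory AlgebraicGeometry TopologicalSpace
open Literature.AlgebraicGeometry.Resolution Literature.AlgebraicGeometry.RelativeSpec
open Summit.ResolutionOfSingularities.ResolutionOfSingularities.Theorems.WildQuotientResolution.S1
open Summit.ResolutionOfSingularities.ResolutionOfSingularities.Theorems.WildQuotientResolution.S1.NodeAtlas

namespace Summit.ResolutionOfSingularities.ResolutionOfSingularities.Theorems.WildQuotientResolution.S1

/-- **A Noetherian regular ring is a tame root chart** (`m = 0`: trivial grading by the trivial group, `𝒜 _ = ⊤`,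
(T1) with the empty set of degrees, (T2) with no extra generators). [OURS · L1 W4.5c] -/
theorem isTameRootChart_of_isRegularRing (A : Type) [CommRing A] [IsNoetherianRing A] (hA : IsRegularRing A) :
    IsTameRootChart A := by
  obtain ⟨𝒜, _, h𝒜, e, -⟩ := exists_trivialGradedRing (Π j : Fin 0, ZMod ((![] : Fin 0 → ℕ) j)) A
  refine ⟨0, ![], A, inferInstance, 𝒜, inferInstance, inferInstance, hA, ?_, ?_, ⟨e⟩⟩
  · exact ⟨∅, fun _ h => absurd h (Finset.notMem_empty _), inferInstance⟩
  · refine ⟨∅, eq_top_iff.mpr fun b _ => Subring.subset_closure (Or.inl ?_)⟩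
    rw [h𝒜 0]; exact AddSubgroup.mem_top b

/-- **A regular locally Noetherian scheme is locally tame-root-regular.** [OURS · L1 W4.5c] -/
theorem locallyTameRootRegular_of_isRegular (Y : Scheme.{0}) [IsLocallyNoetherian Y] (hY : Scheme.IsRegular Y) :
    LocallyTameRootRegular Y := by
  intro y
  obtain ⟨W, hW, hyW, -⟩ := exists_isAffineOpen_mem_and_subset (X := Y) (x := y) (U := ⊤) (Opens.mem_top _)
  haveI : IsNoetherianRing Γ(Y, W) := IsLocallyNoetherian.component_noetherian ⟨W, hW⟩
  exact ⟨⟨W, hW⟩, hyW, isTameRootChart_of_isRegularRing Γ(Y, W) (hY.isRegularRing_of_isAffineOpen hW)⟩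

namespace GameFrame.GModel

variable {p : ℕ} {X' X₁ : Scheme.{0}} {q : X' ⟶ X₁} {G : Type} [Group G] {ρ : G →* Aut X'} {g₀ : G}

/-- **(T0b) KILL points are good**: a point of a `G`-model lying in a `G`-stable affine open, affine over the base,
whose ring of invariants is Noetherian and regular, is not in the bad locus. [OURS · L1 W4.5c] -/
theorem isGoodAt_of_isRegularRing_invariants (M : GModel p q G ρ g₀) (v : M.V) (O : M.act.StableAffineOpens)
    (hv : v ∈ O.1) (hO : IsAffineOpen O.1)
    [IsNoetherianRing ↥((M.act.restrict O.1 O.2.1).invariantsRing ⊤)]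
    (hreg : IsRegularRing ↥((M.act.restrict O.1 O.2.1).invariantsRing ⊤)) : M.IsGoodAt v :=
  ⟨O, hv, hO, isTameRootChart_of_isRegularRing _ hreg⟩

/-- … hence not in the bad locus. -/
theorem notMem_badLocus_of_isRegularRing_invariants (M : GModel p q G ρ g₀) (v : M.V) (O : M.act.StableAffineOpens)
    (hv : v ∈ O.1) (hO : IsAffineOpen O.1)
    [IsNoetherianRing ↥((M.act.restrict O.1 O.2.1).invariantsRing ⊤)]
    (hreg : IsRegularRing ↥((M.act.restrict O.1 O.2.1).invariantsRing ⊤)) : v ∉ M.badLocus := by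
  rw [mem_badLocus_iff, not_not]
  exact M.isGoodAt_of_isRegularRing_invariants v O hv hO hreg

end GameFrame.GModel

end Summit.ResolutionOfSingularities.ResolutionOfSingularities.Theorems.WildQuotientResolution.S1

end
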